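import Mathlib
import Literature.NumberTheory.LFunctions.FeketePolynomial
import Literature.RingTheory.Valuation.AlgClosedResidue
import Literature.RingTheory.Valuation.RootReduction
import Summits.ValiantsHypothesis.ValiantsHypothesis.Theses.FeketeSOS
import Summits.ValiantsHypothesis.ValiantsHypothesis.Theorems.FeketeSOSDepthZeroShadow

/-!
# `FeketeSOS.SublinearShadow` (stmt-ValiantsHypothesis-14990) — the ORDERED bridge (continuation lead c8, line `Sketch`)

The crux-strategist of the sibling crux (★) `CharPSparseSOS` (stmt-14989; `Cruxes/CharPSparseSOS/STRATEGY-CENSUS.md` §R,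
`Strategist_Sketch.lean`) certified a route-level "door": re-glue `closes` through the ORDERED pair
(`CharPSparseSOSOrdered`, `SublinearShadowOrdered`), where `SublinearShadowOrdered` is THIS item with its conclusion kept
EXACT in `K[X]` (`natDegree g'_j ≤ p²` and `Σ C(c'_j)·g'_j² = F̄_p`, no reduction modulo `X^p − 1`).  This file records,
kernel-checked and on the item's side of the ledger, the two facts the re-glue uses about item 14990:

* `sublinearShadow_of_ordered` — the ordered item is STRONGER: its body (inlined verbatim as the hypothesis; the
  strategist's decl lives under `Cruxes/` and is not importable here) implies `SublinearShadow` by the cyclic fold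
  (`osb_fold_rep`: an exact representation in `K[X]` folds to a cyclic one of degree `< p` with no more monomials and the
  same weights).  So the moment an ordered shadow is proved, this item closes; nothing landed for this item is lost.
* `depthZeroShadow_ordered` — the depth-0 engine of the route (`DepthZeroShadow`, stmt-14992, `depthZeroShadow_proof`)
  already produces the ORDERED conclusion: if `Σ c_i g_i² = F_p` over `ℂ` and some valuation subring `O ∋ p` of `ℂ`
  contains every coefficient of every term `c_i g_i²`, then over the residue field `K` of `O` (characteristic `p`) there is
  an EXACT representation `Σ c'_j g'_j² = F̄_p` in `K[X]` with `supp g'_j ⊆ supp g_j` (hence the same degree and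
  monomial budgets).  This is `depthZeroShadow_proof` without its final fold, with the per-term Gauss normalisation
  sharpened to a support INCLUSION (`osb_term_model`).  It is the "provable-now support item DepthZeroShadowOrdered" of the
  census, discharged here in advance so that the re-glued route starts with its depth-0 case closed.

Nothing here bears on the open residual (W6) of line `Sketch`; see `Cruxes/SublinearShadow/Lines/Sketch-dead.md` (v7).
-/

namespace Summit.ValiantsHypothesis.ValiantsHypothesis.Theorems.SublinearShadowSketch

open Polynomial IsLocalRing Finset
open Literature.NumberTheory.LFunctions
open Literature.RingTheory.Valuation
open scoped BigOperators

-- `Summit.ValiantsHypothesis.ValiantsHypothesis.…` is the tree's mandated single-conjunct layout (Sub = Summit).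
set_option linter.dupNamespace false

/-- **Cyclic fold of an exact representation.**  Over any commutative ring, an exact identity
`Σ_j C(a_j)·h_j² = F` yields `g_j` of degree `< p` (for `0 < p`) with `|supp g_j| ≤ |supp h_j|` and
`X^p − 1 ∣ Σ_j C(a_j)·g_j² − F` (fold every exponent modulo `p`). [folklore] -/
theorem osb_fold_rep {k : Type*} [CommRing k] {p s : ℕ} (hp : 0 < p) (a : Fin s → k)
    (h : Fin s → k[X]) (F : k[X]) (hrep : ∑ j, C (a j) * h j ^ 2 = F) :
    ∃ g : Fin s → k[X], (∀ j, (g j).natDegree < p) ∧ (∀ j, (g j).support.card ≤ (h j).support.card) ∧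
      ((X : k[X]) ^ p - 1 ∣ (∑ j, C (a j) * g j ^ 2) - F) := by
  classical
  refine ⟨fun j => ∑ n ∈ (h j).support, C ((h j).coeff n) * X ^ (n % p), fun j => ?_, fun j => ?_, ?_⟩
  · exact dzs_natDegree_fold_lt (h j) hp
  · exact dzs_card_support_fold_le (h j) p
  · exact dzs_dvd_sum_sq_sub a h _ F hrep fun j => dzs_X_pow_sub_one_dvd_fold_sub (h j) p

/-- **The ordered item implies this item.**  The hypothesis is the body of the strategist's
`SublinearShadowOrdered` (census `Cruxes/CharPSparseSOS/STRATEGY-CENSUS.md` §R), verbatim: item 14990 with the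
conclusion kept exact in `K[X]` (`natDegree g'_j ≤ p²`, `Σ C(c'_j)·g'_j² = F̄_p`).  Folding each `g'_j` modulo `X^p − 1`
gives the cyclic conclusion of `SublinearShadow` with the same `A`, `p₁`, `K`, `d`, `c'`. -/
theorem sublinearShadow_of_ordered : (∃ A p₁ : ℕ, ∀ (p : ℕ) [Fact p.Prime], p₁ ≤ p → ∀ (s : ℕ) (c : Fin s → ℂ) (g : Fin s → Polynomial ℂ), (∀ i, (g i).natDegree ≤ p ^ 2) → (∑ i, (g i).support.card) ^ 4 ≤ p ^ 3 → (∑ i, Polynomial.C (c i) * g i ^ 2) = ∑ m ∈ Finset.range p, Polynomial.C ((legendreSym p m : ℤ) : ℂ) * Polynomial.X ^ m → ∃ (K : Type) (_ : Field K) (_ : CharP K p) (d : ℕ) (c' : Fin d → K) (g' : Fin d → Polynomial K), d ≤ (s + 1) ^ A ∧ (∀ j, (g' j).natDegree ≤ p ^ 2) ∧ (∑ j, (g' j).support.card) ≤ (s + 1) ^ A * ∑ i, (g i).support.card ∧ (∑ j, Polynomial.C (c' j) * g' j ^ 2) = ∑ m ∈ Finset.range p, Polynomial.C ((legendreSym p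 m : ℤ) : K) * Polynomial.X ^ m) → Summit.ValiantsHypothesis.ValiantsHypothesis.Theses.FeketeSOS.SublinearShadow := by
  rintro ⟨A, p₁, H⟩
  unfold Summit.ValiantsHypothesis.ValiantsHypothesis.Theses.FeketeSOS.SublinearShadow
  refine ⟨A, p₁, fun p _ hp s c g hdeg hS hrep => ?_⟩
  have hprime : p.Prime := Fact.out
  obtain ⟨K, instF, instC, d, c', g', hd, _hdeg', hsupp', hrep'⟩ := H p hp s c g hdeg hS hrep
  obtain ⟨g'', hdeg'', hsupp'', hdvd''⟩ := osb_fold_rep hprime.pos c' g' _ hrep'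
  refine ⟨K, instF, instC, d, c', g'', hd, hdeg'', ?_, hdvd''⟩
  exact (Finset.sum_le_sum fun j _ => hsupp'' j).trans hsupp'

/-- **Per-term Gauss normalisation with support inclusion** (sharpening of `dzs_term_model`).  If every
coefficient of `c · g²` lies in the valuation subring `O ⊂ ℂ`, then `c · g² = d · H²` coefficientwise for some `d ∈ O`
and some `H ∈ O[X]` with `supp H ⊆ supp g`.  (For `g ≠ 0`: `H = g / a` for a coefficient `a` of `g` of maximal
valuation, `d = c a²`; `gaussVal (H²) = 1` because `H` has a coefficient `1`.) -/
theorem osb_term_model (O : ValuationSubring ℂ) (c : ℂ) (g : ℂ[X])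
    (hT : ∀ n, (C c * g ^ 2).coeff n ∈ O) :
    ∃ (d : O) (H : O[X]), (C d * H ^ 2).map (algebraMap O ℂ) = C c * g ^ 2 ∧ H.support ⊆ g.support := by
  classical
  set ι : O →+* ℂ := algebraMap O ℂ with hι
  have hιinj : Function.Injective ι := IsFractionRing.injective O ℂ
  by_cases hg : g = 0
  · refine ⟨0, 0, ?_, ?_⟩
    · simp [hg]
    · simp
  obtain ⟨i, hi⟩ := exists_valuation_coeff_eq_gaussVal O hg
  set a : ℂ := g.coeff i with ha
  have hva : O.valuation a ≠ 0 := by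
    rw [hi]; exact gaussVal_ne_zero O hg
  have ha0 : a ≠ 0 := (Valuation.ne_zero_iff _).mp hva
  set h : ℂ[X] := C a⁻¹ * g with hh
  have hgauss : gaussVal O h = 1 := by
    rw [hh, gaussVal_C_mul, map_inv₀, ← hi, inv_mul_cancel₀ hva]
  have hcoef : ∀ n, h.coeff n ∈ O := fun n => by
    rw [← O.valuation_le_one_iff]
    calc O.valuation (h.coeff n) ≤ gaussVal O h := valuation_coeff_le_gaussVal O h n
      _ = 1 := hgauss
  obtain ⟨H, hH, hHsupp⟩ := dzs_exists_lift O hcoef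
  have hHi : H.coeff i = 1 := by
    apply hιinj
    rw [← coeff_map, hH, hh, coeff_C_mul, ← ha, inv_mul_cancel₀ ha0, map_one]
  have hHred : (H ^ 2).map (residue O) ≠ 0 := by
    rw [Polynomial.map_pow]
    refine pow_ne_zero 2 fun h0 => ?_
    have h1 := congrArg (fun P => P.coeff i) h0
    simp only [coeff_map, hHi, map_one, coeff_zero] at h1
    exact one_ne_zero h1
  have hgauss2 : gaussVal O (h ^ 2) = 1 := by
    have h2 : h ^ 2 = (H ^ 2).map ι := by
      rw [Polynomial.map_pow, hH]
    rw [h2]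
    exact gaussVal_map_eq_one O hHred
  have hT' : C c * g ^ 2 = C (c * a ^ 2) * h ^ 2 := by
    rw [hh, mul_pow, ← C_pow, ← mul_assoc, ← C_mul, inv_pow, mul_inv_cancel_right₀ (pow_ne_zero 2 ha0)]
  have hd : c * a ^ 2 ∈ O := by
    rw [← O.valuation_le_one_iff]
    have h1 : gaussVal O (C c * g ^ 2) ≤ 1 :=
      gaussVal_le O fun n => (O.valuation_le_one_iff _).mpr (hT n)
    rw [hT', gaussVal_C_mul, hgauss2, mul_one] at h1
    exact h1
  refine ⟨⟨c * a ^ 2, hd⟩, H, ?_, ?_⟩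
  · rw [Polynomial.map_mul, map_C, Polynomial.map_pow, hH, hT']
    rfl
  · rw [hHsupp, hh]
    exact dzs_support_C_mul_subset _ _

/-- **Depth 0 gives an ORDERED shadow** (`DepthZeroShadow` without its final fold; the census's provable-now support
item `DepthZeroShadowOrdered`).  If `Σ_{i<s} c_i g_i² = F_p` over `ℂ` and some valuation subring `O ⊂ ℂ` with `p ∈ 𝔪_O`
contains every coefficient of every term `c_i g_i²`, then over the residue field `K` of `O` — a field of
characteristic `p` — there are `c' : Fin s → K` and `g'_j ∈ K[X]` with `supp g'_j ⊆ supp g_j` (so no more monomials and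
no larger degree) and the EXACT identity `Σ_j C(c'_j)·g'_j² = F̄_p` in `K[X]`. -/
theorem depthZeroShadow_ordered : ∀ (p : ℕ) [Fact p.Prime] (s : ℕ) (c : Fin s → ℂ) (g : Fin s → Polynomial ℂ), (∑ i, Polynomial.C (c i) * g i ^ 2) = ∑ m ∈ Finset.range p, Polynomial.C ((legendreSym p m : ℤ) : ℂ) * Polynomial.X ^ m → (∃ O : ValuationSubring ℂ, ((p : ℕ) : O) ∈ IsLocalRing.maximalIdeal O ∧ ∀ i n, (Polynomial.C (c i) * g i ^ 2).coeff n ∈ O) → ∃ (K : Type) (_ : Field K) (_ : CharP K p) (c' : Fin s → K) (g' : Fin s → Polynomial K), (∀ j, (g' j).support ⊆ (g j).support) ∧ (∑ j, Polynomial.C (c' j) * g' j ^ 2) = ∑ m ∈ Finset.range p, Polynomial.C ((legendreSym p m : ℤ) : K) * Polynomial.X ^ m := by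
  intro p _ s c g hrep hO
  obtain ⟨O, hpO, hcoef⟩ := hO
  classical
  haveI hchar : CharP (ResidueField O) p := charP_residueField O hpO
  set ι : O →+* ℂ := algebraMap O ℂ with hι
  have hιinj : Function.Injective ι := IsFractionRing.injective O ℂ
  set ρ : O →+* ResidueField O := residue O with hρ
  -- per-term models over `O`, with support inclusion
  choose d H hdH hHsupp using fun i => osb_term_model O (c i) (g i) (hcoef i)
  have hFmap : ∀ (R S : Type) [CommRing R] [CommRing S] (f : R →+* S),
      ((feketePolynomial p).map (Int.castRingHom R)).map f
        = (feketePolynomial p).map (Int.castRingHom S) := fun R S _ _ f => by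
    rw [Polynomial.map_map, RingHom.ext_int (f.comp (Int.castRingHom R)) (Int.castRingHom S)]
  have hFK : (feketePolynomial p).map (Int.castRingHom (ResidueField O)) =
      ∑ m ∈ Finset.range p, C ((legendreSym p m : ℤ) : ResidueField O) * X ^ m := by
    simp only [map_feketePolynomial, eq_intCast]
  -- (1) the identity in `O[X]`
  have hrepO : (∑ i, C (d i) * H i ^ 2) = (feketePolynomial p).map (Int.castRingHom O) := by
    apply Polynomial.map_injective ι hιinj
    rw [hFmap O ℂ ι, map_feketePolynomial_complex, ← hrep, Polynomial.map_sum]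
    exact Finset.sum_congr rfl fun i _ => hdH i
  -- (2) pushed to the residue field, EXACTLY (no fold)
  refine ⟨ResidueField O, inferInstance, hchar, fun i => ρ (d i), fun i => (H i).map ρ, fun j => ?_, ?_⟩
  · exact (support_map_subset _ _).trans (hHsupp j)
  · rw [← hFK, ← hFmap O (ResidueField O) ρ, ← hrepO, Polynomial.map_sum]
    refine Finset.sum_congr rfl fun i _ => ?_
    rw [Polynomial.map_mul, Polynomial.map_pow, map_C]

end Summit.ValiantsHypothesis.ValiantsHypothesis.Theorems.SublinearShadowSketch
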